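import Mathlib
import Literature.NumberTheory.LFunctions.Zhang2022.TypedAppendixA1
import HarnessLib

/-!
# Zhang (2022), Appendix A part 1 — the exact (s-free / χ-vanishing) leaves, DISCHARGED

Topic `Literature/NumberTheory/LFunctions/Zhang2022` (Landau–Siegel audit tree; verdict-neutral).
Companion (theorem-only) of `TypedAppendixA1` (Y. Zhang, arXiv:2211.02515v1, Appendix A
pp. 101–103 [Zhang2022LandauSiegel]): kernel proofs of those typed CLAIMS of the printed proof of
Lemma 8.3 / of the prerequisites of Lemmas 15.2–15.3 that are finite algebra over the definitions —
no analysis, no published fact, no numerics: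

| node | decl | content |
|---|---|---|
| `Z22:§A.u008` text | `stepA_u008_dvd_holds` | `𝒯_j(d,h,s;q) = 1` for `q ∣ D` (`χ(q) = 0`) |
| `Z22:§A.u020` | `stepA_u020_holds` | `κ̃₁(q^r;dq) = κ₁(q^r)` (only `h = 1` survives in (15.9)) |
| `Z22:(A.5)` | `eqA_5_holds` | `ξ₁(q^r;d,l) = κ̃₁(q^r;d) − χ(q)q(q−1)⁻¹κ₁(q^{r−1})` if `(q,l)=1`, `= κ̃₁(q^r;d)` if `q∣l` |

These discharge typed nodes; they say nothing about Theorems 1–2. (The Lemma-8.3-side identities —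
u002, u004 lead-in, the Case 1–3 identities u010/u016/u017/u018 — and (A.1)–(A.3) belong to the
Lemma 8.3 discharge unit (cell seat sz-d55, file `AppendixALemma83Local`) and are not touched here.)

## References

* Y. Zhang, arXiv:2211.02515v1 (2022), Appendix A pp. 101–103; §7 p. 32; §15 (15.9), (15.13).
  [cite: Zhang2022LandauSiegel, App. A]
-/

noncomputable section

open Complex Real

namespace Literature.NumberTheory.LFunctions.Zhang2022.Typed.AppendixA1

open Literature.NumberTheory.LFunctions.Zhang2022
open Literature.NumberTheory.LFunctions.Zhang2022.Skeleton

/-- For `q ∣ D` prime (`D ≥ 1`), `χ(q) = 0` — the reason "`𝒯_j(d,h,s;q) = 1` if `q ∣ D`" (App. A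
p.101, tex L5006). [cite: Zhang2022LandauSiegel, App. A p.101, tex L5006] -/
theorem chi_eq_zero_of_dvd {D : ℕ} [NeZero D] (χ : DirichletCharacter ℂ D) {q : ℕ} (hq : q.Prime)
    (hqD : q ∣ D) : χ (q : ZMod D) = 0 := by
  apply χ.map_nonunit
  rw [ZMod.isUnit_iff_coprime]
  intro hcop
  have h1 : q ∣ Nat.gcd q D := Nat.dvd_gcd dvd_rfl hqD
  rw [hcop] at h1
  exact hq.one_lt.ne' (Nat.dvd_one.mp h1)

/-- **Z22:§A.u008 (text) holds**: `𝒯_j(d,h,s;q) = 1` if `q ∣ D` (then `χ(q) = 0`, so the first factor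
is `1` and the `r`-series vanishes). [cite: Zhang2022LandauSiegel, App. A p.101, tex L5006] -/
theorem stepA_u008_dvd_holds (c' : ℝ) : StepA_u008_dvd c' := by
  intro D _ χ j d h q hq hqD s
  have hχ : χ (q : ZMod D) = 0 := chi_eq_zero_of_dvd χ hq hqD
  have hχpow : ∀ r : ℕ, χ ((q ^ (r + 1) : ℕ) : ZMod D) = 0 := by
    intro r
    rw [Nat.cast_pow, map_pow, hχ, zero_pow (Nat.succ_ne_zero r)]
  unfold frakt pref xiPowSum
  simp only [hχ, hχpow, zero_mul, sub_zero, div_one, mul_one, zero_div, tsum_zero, mul_zero,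
    add_zero]

variable (c' : ℝ) in
/-- `StepA_u008_dvd` — `_holds` alias of `stepA_u008_dvd_holds` above under the fact's exact name, stated under the
prover's own binders as section variables (appended 2026-08-28, D-0026 bookkeeping: the proof term is the
existing theorem of this file; no statement, definition or attribute is edited; no new named fact; the
ledger's debt table listed the fact unproved). [cite: Zhang2022LandauSiegel, App. A p.101, tex L5006] -/
theorem _root_.Literature.NumberTheory.LFunctions.Zhang2022.Typed.AppendixA1.StepA_u008_dvd_holds :
    _root_.Literature.NumberTheory.LFunctions.Zhang2022.Typed.AppendixA1.StepA_u008_dvd c' :=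
  _root_.Literature.NumberTheory.LFunctions.Zhang2022.Typed.AppendixA1.stepA_u008_dvd_holds (c' := c')

/-- In the series `κ̃₁(q^r; dq, s)` only the term `h = 1` is non-zero: an `h > 1` with all prime
factors dividing `q^r` is divisible by `q`, hence not coprime to `dq` (the set `𝔫(d)` of §7
p.32). [cite: Zhang2022LandauSiegel, §7 p.32; App. A p.103, tex L5105] -/
theorem nset_pow_coprime_mul {q r d h : ℕ} (hne : h ≠ 1)
    (hmem : h ∈ nset (q ^ r)) (hcop : Nat.Coprime h (d * q)) : False := by
  obtain ⟨-, hprim⟩ := hmem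
  obtain ⟨p, hp, hph⟩ := Nat.exists_prime_and_dvd hne
  have hpq : p ∣ q := hp.dvd_of_dvd_pow (hprim p hp hph)
  have h1 : p ∣ Nat.gcd h (d * q) := Nat.dvd_gcd hph (dvd_mul_of_dvd_right hpq d)
  rw [hcop] at h1
  exact hp.one_lt.ne' (Nat.dvd_one.mp h1)

/-- `1 ∈ 𝔫(n)` for every `n`. [cite: Zhang2022LandauSiegel, §7 p.32] -/
theorem one_mem_nset (n : ℕ) : (1 : ℕ) ∈ nset n :=
  ⟨Nat.one_pos, fun p _ hp1 => by rw [Nat.dvd_one.mp hp1]; exact one_dvd _⟩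

/-- **Z22:§A.u020 holds**: `κ̃₁(q^r;dq) = κ₁(q^r)` (`κ̃₁(·;·) = κ̃₁(·;·,1)`).
[cite: Zhang2022LandauSiegel, App. A p.103, tex L5105] -/
theorem stepA_u020_holds (c' : ℝ) : StepA_u020 c' := by
  intro D _ χ d q r hd hq
  classical
  unfold kappaTilde1
  have hzero : ∀ h : ℕ, h ≠ 1 →
      (if h ∈ nset (q ^ r) ∧ Nat.Coprime h (d * q) then
          kappa1 c' D (q ^ r * h) * χ (h : ZMod D) / (h : ℂ) ^ (1 : ℂ) else 0) = 0 := by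
    intro h hne
    rw [if_neg]
    exact fun hh => nset_pow_coprime_mul hne hh.1 hh.2
  rw [tsum_eq_single 1 hzero, if_pos ⟨one_mem_nset _, Nat.coprime_one_left _⟩]
  simp

variable (c' : ℝ) in
/-- `StepA_u020` — `_holds` alias of `stepA_u020_holds` above under the fact's exact name, stated under the
prover's own binders as section variables (appended 2026-08-28, D-0026 bookkeeping: the proof term is the
existing theorem of this file; no statement, definition or attribute is edited; no new named fact; the
ledger's debt table listed the fact unproved). [cite: Zhang2022LandauSiegel, App. A p.103, tex L5105] -/
theorem _root_.Literature.NumberTheory.LFunctions.Zhang2022.Typed.AppendixA1.StepA_u020_holds :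
    _root_.Literature.NumberTheory.LFunctions.Zhang2022.Typed.AppendixA1.StepA_u020 c' :=
  _root_.Literature.NumberTheory.LFunctions.Zhang2022.Typed.AppendixA1.stepA_u020_holds (c' := c')

/-- The value `κ̃₁(q^{n+1}/q; dq) = κ₁(q^n)` used in (A.5) (u020 with `q^{n+1}/q = q^n`).
[cite: Zhang2022LandauSiegel, App. A p.103, tex L5105] -/
theorem kappaTilde1_pow_div (c' : ℝ) {D : ℕ} [NeZero D] (χ : DirichletCharacter ℂ D) {d q : ℕ}
    (n : ℕ) (hd : 1 ≤ d) (hq : q.Prime) :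
    kappaTilde1 c' χ (q ^ (n + 1) / q) (d * q) 1 = kappa1 c' D (q ^ n) := by
  rw [pow_succ, Nat.mul_div_cancel _ hq.pos]
  exact stepA_u020_holds c' D χ d q n hd hq

/-- **(A.5) holds** (Z22:(A.5)): for `q` prime, `d, l, r ≥ 1`,
`ξ₁(q^r;d,l) = κ̃₁(q^r;d) − χ(q)q(q−1)⁻¹κ₁(q^{r−1})` if `(q,l) = 1` and `= κ̃₁(q^r;d)` if `q ∣ l`:
in (15.13) only the divisors `k = 1` and `k = q` of `q^r` carry `μ(k) ≠ 0`.
[cite: Zhang2022LandauSiegel, App. A (A.5) p.103, tex L5109] -/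
theorem eqA_5_holds (c' : ℝ) : EqA_5 c' := by
  intro D _ χ q d l r hq hd hl hr
  classical
  obtain ⟨n, rfl⟩ : ∃ n, r = n + 1 := ⟨r - 1, by omega⟩
  -- expand ξ₁(q^{n+1};d,l) as a sum over the exponents i ≤ n+1 of the divisors q^i
  have hexp : xiOne c' χ (q ^ (n + 1)) d l =
      ∑ i ∈ Finset.range (n + 2), (if Nat.Coprime (q ^ i) l then
        (ArithmeticFunction.moebius (q ^ i) : ℂ) * χ ((q ^ i : ℕ) : ZMod D) * ((q ^ i : ℕ) : ℂ) /
            (Nat.totient (q ^ i) : ℂ) * kappaTilde1 c' χ (q ^ (n + 1) / q ^ i) (d * q ^ i) 1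
        else 0) := by
    unfold xiOne
    rw [Finset.sum_filter, Nat.sum_divisors_prime_pow hq]
  -- the terms with i ≥ 2 vanish (μ(q^i) = 0)
  have htail : ∀ i ∈ Finset.range n, (if Nat.Coprime (q ^ (i + 1 + 1)) l then
        (ArithmeticFunction.moebius (q ^ (i + 1 + 1)) : ℂ) * χ ((q ^ (i + 1 + 1) : ℕ) : ZMod D) *
            ((q ^ (i + 1 + 1) : ℕ) : ℂ) / (Nat.totient (q ^ (i + 1 + 1)) : ℂ) *
          kappaTilde1 c' χ (q ^ (n + 1) / q ^ (i + 1 + 1)) (d * q ^ (i + 1 + 1)) 1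
        else 0) = 0 := by
    intro i _
    have hμ : ArithmeticFunction.moebius (q ^ (i + 1 + 1)) = 0 := by
      rw [ArithmeticFunction.moebius_apply_prime_pow hq (by omega)]
      simp
    simp [hμ]
  -- the term i = 0
  have h0 : (if Nat.Coprime (q ^ 0) l then
        (ArithmeticFunction.moebius (q ^ 0) : ℂ) * χ ((q ^ 0 : ℕ) : ZMod D) * ((q ^ 0 : ℕ) : ℂ) /
            (Nat.totient (q ^ 0) : ℂ) * kappaTilde1 c' χ (q ^ (n + 1) / q ^ 0) (d * q ^ 0) 1
        else 0) = kappaTilde1 c' χ (q ^ (n + 1)) d 1 := by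
    rw [if_pos (by simp)]
    simp
  -- the value of the term i = 1 when (q,l) = 1
  have hφ : (Nat.totient q : ℂ) = (q : ℂ) - 1 := by
    rw [Nat.totient_prime hq, Nat.cast_sub hq.one_le, Nat.cast_one]
  rw [hexp, Finset.sum_range_succ', Finset.sum_range_succ', Finset.sum_eq_zero htail, zero_add, h0]
  refine ⟨fun hcop => ?_, fun hdvd => ?_⟩
  · rw [if_pos (by simpa using hcop)]
    simp only [zero_add, pow_one, Nat.add_sub_cancel]
    rw [kappaTilde1_pow_div c' χ n hd hq, ArithmeticFunction.moebius_apply_prime hq, hφ]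
    push_cast
    ring
  · have hnc : ¬ Nat.Coprime (q ^ (0 + 1)) l := by
      rw [zero_add, pow_one, hq.coprime_iff_not_dvd, not_not]
      exact hdvd
    rw [if_neg hnc, zero_add]

variable (c' : ℝ) in
/-- `EqA_5` — `_holds` alias of `eqA_5_holds` above under the fact's exact name, stated under the
prover's own binders as section variables (appended 2026-08-28, D-0026 bookkeeping: the proof term is the
existing theorem of this file; no statement, definition or attribute is edited; no new named fact; the
ledger's debt table listed the fact unproved). [cite: Zhang2022LandauSiegel, App. A (A.5) p.103, tex L5109] -/
theorem _root_.Literature.NumberTheory.LFunctions.Zhang2022.Typed.AppendixA1.EqA_5_holds :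
    _root_.Literature.NumberTheory.LFunctions.Zhang2022.Typed.AppendixA1.EqA_5 c' :=
  _root_.Literature.NumberTheory.LFunctions.Zhang2022.Typed.AppendixA1.eqA_5_holds (c' := c')

end Literature.NumberTheory.LFunctions.Zhang2022.Typed.AppendixA1
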